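import Summits.HodgeConjecture.HodgeConjecture.Theorems.HodgeLocusCensusPlaneSumStackCert
import Summits.HodgeConjecture.HodgeConjecture.Theorems.HodgeLocusCensusPlaneSumRank4
import HarnessLib

/-!
# HodgeLocusCensusPlaneSumStackRank4 — a valid stacked certificate decides rank [M_{δ₁} ; M_{δ₂}] of two signed plane sums on the Fermat quartic FOURFOLD (cell pub-hlocus, LEAD gen 5, (T37))
HONEST FRAMING: certified instances and evidence bearing on the general Hodge conjecture; no claim.

MAIN THEOREM `ivhsStackRankEq_of_cert4`: for classes L1, L2 (signed head-twisted coordinate planes), a stacked certificate Ψ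
(`HodgeLocusCensusPlaneSumStackCert.StackCert`) with `Ψ.valid L1 L2 = true` and a type-major enumeration of the r modes (`modeK`, `off`,
H1–H3 exactly as in `HodgeLocusCensusPlaneSumRank4`), rank (fromRows M_{δ₁} M_{δ₂}) = r for δ_i = planeList4 L_i, over every field of
characteristic 0 and every primitive 8th root ζ. Upper bound: [M₁ ; M₂] = [U⁰ ; U¹] · V through K^r — each layer factors through the SAME
right factor V by (F) of the certificate (`ivhsMatrix_layer4_eq_mul`, `Matrix.fromRows_mul`). Lower bound: the r × r minor on the pivot
rows ρ(m) = (layer ; h ; σ − h ; tails) ∈ I ⊕ I and pivot columns γ(m) is (lower triangular, nonzero diagonal) · (upper triangular, nonzero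
diagonal) by (T), (P). The entry formula and the pivot-row / column arithmetic (`mkRow4`, `mkCol4`, …) are reused from `HodgeLocusCensusPlaneSumRank4`.
-/

namespace Summit.HodgeConjecture.HodgeConjecture.HodgeLocus.Census.PlaneSum

open TwistCells PlaneRank

section cert

variable {K : Type*} [Field K] (ζ : K) (L1 L2 : List (ℤ × ℕ × ℕ × ℕ)) (Ψ : StackCert) {r : ℕ} (modeK : Fin r → Fin 6) (off : Fin 6 → ℕ)

/-- left factor of layer `lay`: U^{lay}[i, m] = [type(i) = type(m)] · A_{σ}[(lay, head(i)), ℓ(m)](ζ). -/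
noncomputable def SU4 (lay : ℕ) : Matrix (indexSet 4 4 (4 / 2 * 4 - 4 - 2)) (Fin r) K := fun i m =>
  if i.1 0 + i.1 1 = sig0 (modeK m) ∧ i.1 2 + i.1 3 = sig1 (modeK m) ∧ i.1 4 + i.1 5 = sig2 (modeK m) then
    Z8.eval ζ (Ψ.A (sig0 (modeK m)) (sig1 (modeK m)) (sig2 (modeK m)) lay (i.1 0) (i.1 2) (i.1 4) (m.1 - off (modeK m))) else 0

/-- common right factor: V[m, j] = [type(j) complementary to type(m)] · B_{σ}[ℓ(m), head(j)](ζ). -/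
noncomputable def SV4 : Matrix (Fin r) (indexSet 4 4 4) K := fun m j =>
  if sig0 (modeK m) + (j.1 0 + j.1 1) = 2 ∧ sig1 (modeK m) + (j.1 2 + j.1 3) = 2 ∧ sig2 (modeK m) + (j.1 4 + j.1 5) = 2 then
    Z8.eval ζ (Ψ.B (sig0 (modeK m)) (sig1 (modeK m)) (sig2 (modeK m)) (m.1 - off (modeK m)) (j.1 0) (j.1 2) (j.1 4)) else 0

/-- STRUCTURE THEOREM per layer: M_{δ_lay} = U^{lay} · V through K^r. -/
theorem ivhsMatrix_layer4_eq_mul (h4 : ζ ^ 4 = -1) (hV : Ψ.valid L1 L2 = true) {lay : ℕ} (hlay : lay < 2)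
    (H1 : ∀ m : Fin r, off (modeK m) ≤ m.1 ∧ m.1 < off (modeK m) + srs4 Ψ (modeK m)) (H2 : ∀ k : Fin 6, off k + srs4 Ψ k ≤ r)
    (H3 : ∀ m : Fin r, ∀ k : Fin 6, off k ≤ m.1 → m.1 < off k + srs4 Ψ k → modeK m = k) :
    ivhsMatrix 4 4 ζ (planeList4 (layer L1 L2 lay)) = SU4 ζ Ψ modeK off lay * SV4 ζ Ψ modeK off := by
  ext i j
  rw [Matrix.mul_apply, ivhsMatrix_planeList4_apply ζ (layer L1 L2 lay) h4]
  obtain ⟨k₀, h0, h1, h2⟩ := row_cover i.1 i.2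
  obtain ⟨l0, l1, l2⟩ := Zprime4.sig_le4 k₀
  have hU : ∀ m : Fin r, modeK m ≠ k₀ → SU4 ζ Ψ modeK off lay i m = 0 := by
    intro m hm
    unfold SU4
    rw [if_neg]
    intro h
    exact hm (sig_inj _ _ (h.1.symm.trans h0) (h.2.1.symm.trans h1) (h.2.2.symm.trans h2))
  by_cases hc : sig0 k₀ + (j.1 0 + j.1 1) = 2 ∧ sig1 k₀ + (j.1 2 + j.1 3) = 2 ∧ sig2 k₀ + (j.1 4 + j.1 5) = 2
  · rw [if_pos ⟨by omega, by omega, by omega⟩]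
    set g : ℕ → K := fun ℓ => Z8.eval ζ (Ψ.A (sig0 k₀) (sig1 k₀) (sig2 k₀) lay (i.1 0) (i.1 2) (i.1 4) ℓ) *
      Z8.eval ζ (Ψ.B (sig0 k₀) (sig1 k₀) (sig2 k₀) ℓ (j.1 0) (j.1 2) (j.1 4)) with hg
    have hterm : ∀ m : Fin r, SU4 ζ Ψ modeK off lay i m * SV4 ζ Ψ modeK off m j = if modeK m = k₀ then g (m.1 - off k₀) else 0 := by
      intro m
      by_cases hm : modeK m = k₀
      · rw [if_pos hm, hg]
        unfold SU4 SV4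
        rw [hm, if_pos ⟨h0, h1, h2⟩, if_pos hc]
      · rw [if_neg hm, hU m hm, zero_mul]
    rw [Finset.sum_congr rfl fun m _ => hterm m, sum_modes modeK off (srs4 Ψ) H1 H2 H3 k₀ g,
      ← StackCert.factor_eq hV (s0 := sig0 k₀) (s1 := sig1 k₀) (s2 := sig2 k₀) (lay := lay) (a := i.1 0) (b := i.1 2) (e := i.1 4)
        (a' := j.1 0) (b' := j.1 2) (e' := j.1 4) (by omega) (by omega) (by omega) hlay (by omega) (by omega) (by omega) (by omega)
        (by omega) (by omega), Z8.eval_rsum]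
    exact Finset.sum_congr rfl fun ℓ _ => by rw [hg, Z8.eval_mul ζ h4]
  · rw [if_neg fun h => hc ⟨by omega, by omega, by omega⟩]
    symm
    refine Finset.sum_eq_zero fun m _ => ?_
    by_cases hm : modeK m = k₀
    · unfold SV4
      rw [hm, if_neg hc, mul_zero]
    · rw [hU m hm, zero_mul]

/-- STRUCTURE THEOREM, stacked: [M_{δ₁} ; M_{δ₂}] = [U⁰ ; U¹] · V. -/
theorem ivhsMatrix_stack4_eq_mul (h4 : ζ ^ 4 = -1) (hV : Ψ.valid L1 L2 = true)
    (H1 : ∀ m : Fin r, off (modeK m) ≤ m.1 ∧ m.1 < off (modeK m) + srs4 Ψ (modeK m)) (H2 : ∀ k : Fin 6, off k + srs4 Ψ k ≤ r)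
    (H3 : ∀ m : Fin r, ∀ k : Fin 6, off k ≤ m.1 → m.1 < off k + srs4 Ψ k → modeK m = k) :
    Matrix.fromRows (ivhsMatrix 4 4 ζ (planeList4 L1)) (ivhsMatrix 4 4 ζ (planeList4 L2)) =
      Matrix.fromRows (SU4 ζ Ψ modeK off 0) (SU4 ζ Ψ modeK off 1) * SV4 ζ Ψ modeK off := by
  rw [Matrix.fromRows_mul, ← ivhsMatrix_layer4_eq_mul ζ L1 L2 Ψ modeK off h4 hV (lay := 0) (by omega) H1 H2 H3,
    ← ivhsMatrix_layer4_eq_mul ζ L1 L2 Ψ modeK off h4 hV (lay := 1) (by omega) H1 H2 H3, layer_zero, layer_one]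

/-- UPPER BOUND: rank [M_{δ₁} ; M_{δ₂}] ≤ r. -/
theorem stackRank_le_of_cert4 (h4 : ζ ^ 4 = -1) (hV : Ψ.valid L1 L2 = true)
    (H1 : ∀ m : Fin r, off (modeK m) ≤ m.1 ∧ m.1 < off (modeK m) + srs4 Ψ (modeK m)) (H2 : ∀ k : Fin 6, off k + srs4 Ψ k ≤ r)
    (H3 : ∀ m : Fin r, ∀ k : Fin 6, off k ≤ m.1 → m.1 < off k + srs4 Ψ k → modeK m = k) :
    (Matrix.fromRows (ivhsMatrix 4 4 ζ (planeList4 L1)) (ivhsMatrix 4 4 ζ (planeList4 L2))).rank ≤ r := by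
  rw [ivhsMatrix_stack4_eq_mul ζ L1 L2 Ψ modeK off h4 hV H1 H2 H3]
  exact (Matrix.rank_mul_le_left _ _).trans
    (by simpa using Matrix.rank_le_card_width (Matrix.fromRows (SU4 ζ Ψ modeK off 0) (SU4 ζ Ψ modeK off 1)))

/-! ### the witness minor -/

variable {L1 L2 Ψ modeK off}

/-- ℓ(m) < r_{shape(m)}. -/
theorem smodeL_lt4 (H1 : ∀ m : Fin r, off (modeK m) ≤ m.1 ∧ m.1 < off (modeK m) + srs4 Ψ (modeK m)) (m : Fin r) :
    m.1 - off (modeK m) < srs4 Ψ (modeK m) := by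
  have := H1 m
  omega

/-- the layer and box facts of the pivots of mode m. -/
theorem spivot_box4 (hV : Ψ.valid L1 L2 = true) (H1 : ∀ m : Fin r, off (modeK m) ≤ m.1 ∧ m.1 < off (modeK m) + srs4 Ψ (modeK m)) (m : Fin r) :
    (Ψ.rowP (sig0 (modeK m)) (sig1 (modeK m)) (sig2 (modeK m)) (m.1 - off (modeK m))).1 ≤ 1 ∧
    ((Ψ.rowP (sig0 (modeK m)) (sig1 (modeK m)) (sig2 (modeK m)) (m.1 - off (modeK m))).2.1 ≤ sig0 (modeK m) ∧
      (Ψ.rowP (sig0 (modeK m)) (sig1 (modeK m)) (sig2 (modeK m)) (m.1 - off (modeK m))).2.2.1 ≤ sig1 (modeK m) ∧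
      (Ψ.rowP (sig0 (modeK m)) (sig1 (modeK m)) (sig2 (modeK m)) (m.1 - off (modeK m))).2.2.2 ≤ sig2 (modeK m)) ∧
    ((Ψ.colP (sig0 (modeK m)) (sig1 (modeK m)) (sig2 (modeK m)) (m.1 - off (modeK m))).1 ≤ 2 - sig0 (modeK m) ∧
      (Ψ.colP (sig0 (modeK m)) (sig1 (modeK m)) (sig2 (modeK m)) (m.1 - off (modeK m))).2.1 ≤ 2 - sig1 (modeK m) ∧
      (Ψ.colP (sig0 (modeK m)) (sig1 (modeK m)) (sig2 (modeK m)) (m.1 - off (modeK m))).2.2 ≤ 2 - sig2 (modeK m)) := by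
  obtain ⟨l0, l1, l2⟩ := Zprime4.sig_le4 (modeK m)
  obtain ⟨-, -, hb⟩ := StackCert.pivots hV (by omega) (by omega) (by omega) (smodeL_lt4 H1 m)
  exact ⟨hb.1, ⟨hb.2.1, hb.2.2.1, hb.2.2.2.1⟩, hb.2.2.2.2⟩

/-- the pivot row of mode m inside its layer … -/
def srow4 (hV : Ψ.valid L1 L2 = true) (H1 : ∀ m : Fin r, off (modeK m) ≤ m.1 ∧ m.1 < off (modeK m) + srs4 Ψ (modeK m)) (m : Fin r) :
    indexSet 4 4 (4 / 2 * 4 - 4 - 2) :=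
  ⟨mkRow4 (modeK m) (Ψ.rowP (sig0 (modeK m)) (sig1 (modeK m)) (sig2 (modeK m)) (m.1 - off (modeK m))).2,
    mkRow4_mem _ _ (spivot_box4 hV H1 m).2.1⟩

/-- … placed in its layer of I ⊕ I … -/
def srho4 (hV : Ψ.valid L1 L2 = true) (H1 : ∀ m : Fin r, off (modeK m) ≤ m.1 ∧ m.1 < off (modeK m) + srs4 Ψ (modeK m)) (m : Fin r) :
    indexSet 4 4 (4 / 2 * 4 - 4 - 2) ⊕ indexSet 4 4 (4 / 2 * 4 - 4 - 2) :=
  if (Ψ.rowP (sig0 (modeK m)) (sig1 (modeK m)) (sig2 (modeK m)) (m.1 - off (modeK m))).1 = 0 then Sum.inl (srow4 hV H1 m)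
  else Sum.inr (srow4 hV H1 m)

/-- … and its pivot column. -/
def sgam4 (hV : Ψ.valid L1 L2 = true) (H1 : ∀ m : Fin r, off (modeK m) ≤ m.1 ∧ m.1 < off (modeK m) + srs4 Ψ (modeK m)) (m : Fin r) :
    indexSet 4 4 4 :=
  ⟨mkCol4 (modeK m) (Ψ.colP (sig0 (modeK m)) (sig1 (modeK m)) (sig2 (modeK m)) (m.1 - off (modeK m))), mkCol4_mem _ _ (spivot_box4 hV H1 m).2.2⟩

/-- heads and pair sums of ρ(m) … -/
theorem srow4_val (hV : Ψ.valid L1 L2 = true) (H1 : ∀ m : Fin r, off (modeK m) ≤ m.1 ∧ m.1 < off (modeK m) + srs4 Ψ (modeK m)) (m : Fin r) :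
    (srow4 hV H1 m).1 0 = (Ψ.rowP (sig0 (modeK m)) (sig1 (modeK m)) (sig2 (modeK m)) (m.1 - off (modeK m))).2.1 ∧
    (srow4 hV H1 m).1 2 = (Ψ.rowP (sig0 (modeK m)) (sig1 (modeK m)) (sig2 (modeK m)) (m.1 - off (modeK m))).2.2.1 ∧
    (srow4 hV H1 m).1 4 = (Ψ.rowP (sig0 (modeK m)) (sig1 (modeK m)) (sig2 (modeK m)) (m.1 - off (modeK m))).2.2.2 ∧
    (srow4 hV H1 m).1 0 + (srow4 hV H1 m).1 1 = sig0 (modeK m) ∧ (srow4 hV H1 m).1 2 + (srow4 hV H1 m).1 3 = sig1 (modeK m) ∧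
    (srow4 hV H1 m).1 4 + (srow4 hV H1 m).1 5 = sig2 (modeK m) :=
  mkRow4_val (modeK m) _ (spivot_box4 hV H1 m).2.1

/-- … and of γ(m). -/
theorem sgam4_val (hV : Ψ.valid L1 L2 = true) (H1 : ∀ m : Fin r, off (modeK m) ≤ m.1 ∧ m.1 < off (modeK m) + srs4 Ψ (modeK m)) (m : Fin r) :
    (sgam4 hV H1 m).1 0 = (Ψ.colP (sig0 (modeK m)) (sig1 (modeK m)) (sig2 (modeK m)) (m.1 - off (modeK m))).1 ∧
    (sgam4 hV H1 m).1 2 = (Ψ.colP (sig0 (modeK m)) (sig1 (modeK m)) (sig2 (modeK m)) (m.1 - off (modeK m))).2.1 ∧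
    (sgam4 hV H1 m).1 4 = (Ψ.colP (sig0 (modeK m)) (sig1 (modeK m)) (sig2 (modeK m)) (m.1 - off (modeK m))).2.2 ∧
    sig0 (modeK m) + ((sgam4 hV H1 m).1 0 + (sgam4 hV H1 m).1 1) = 2 ∧ sig1 (modeK m) + ((sgam4 hV H1 m).1 2 + (sgam4 hV H1 m).1 3) = 2 ∧
    sig2 (modeK m) + ((sgam4 hV H1 m).1 4 + (sgam4 hV H1 m).1 5) = 2 :=
  mkCol4_val (modeK m) _ (spivot_box4 hV H1 m).2.2

/-- U^{lay} on the pivot row of mode m (any layer argument): supported on the modes of the same type, with value A_σ[h_{ℓ(m)}, ℓ(m')]. -/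
theorem SU4_srow (hV : Ψ.valid L1 L2 = true) (H1 : ∀ m : Fin r, off (modeK m) ≤ m.1 ∧ m.1 < off (modeK m) + srs4 Ψ (modeK m))
    (lay : ℕ) (m m' : Fin r) :
    SU4 ζ Ψ modeK off lay (srow4 hV H1 m) m' = if modeK m' = modeK m then
      Z8.eval ζ (Ψ.A (sig0 (modeK m)) (sig1 (modeK m)) (sig2 (modeK m)) lay
        (Ψ.rowP (sig0 (modeK m)) (sig1 (modeK m)) (sig2 (modeK m)) (m.1 - off (modeK m))).2.1
        (Ψ.rowP (sig0 (modeK m)) (sig1 (modeK m)) (sig2 (modeK m)) (m.1 - off (modeK m))).2.2.1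
        (Ψ.rowP (sig0 (modeK m)) (sig1 (modeK m)) (sig2 (modeK m)) (m.1 - off (modeK m))).2.2.2 (m'.1 - off (modeK m))) else 0 := by
  obtain ⟨e0, e2, e4, p0, p1, p2⟩ := srow4_val hV H1 m
  unfold SU4
  rw [p0, p1, p2, e0, e2, e4]
  by_cases hk : modeK m' = modeK m
  · rw [if_pos hk, hk, if_pos ⟨rfl, rfl, rfl⟩]
  · rw [if_neg hk, if_neg]
    intro h
    exact hk (sig_inj _ _ h.1.symm h.2.1.symm h.2.2.symm)

/-- [U⁰ ; U¹] on the pivot row ρ(m): the value of U^{layer(m)}. -/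
theorem SU4_rho (hV : Ψ.valid L1 L2 = true) (H1 : ∀ m : Fin r, off (modeK m) ≤ m.1 ∧ m.1 < off (modeK m) + srs4 Ψ (modeK m)) (m m' : Fin r) :
    Matrix.fromRows (SU4 ζ Ψ modeK off 0) (SU4 ζ Ψ modeK off 1) (srho4 hV H1 m) m' = if modeK m' = modeK m then
      Z8.eval ζ (Ψ.A (sig0 (modeK m)) (sig1 (modeK m)) (sig2 (modeK m))
        (Ψ.rowP (sig0 (modeK m)) (sig1 (modeK m)) (sig2 (modeK m)) (m.1 - off (modeK m))).1
        (Ψ.rowP (sig0 (modeK m)) (sig1 (modeK m)) (sig2 (modeK m)) (m.1 - off (modeK m))).2.1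
        (Ψ.rowP (sig0 (modeK m)) (sig1 (modeK m)) (sig2 (modeK m)) (m.1 - off (modeK m))).2.2.1
        (Ψ.rowP (sig0 (modeK m)) (sig1 (modeK m)) (sig2 (modeK m)) (m.1 - off (modeK m))).2.2.2 (m'.1 - off (modeK m))) else 0 := by
  have hl : (Ψ.rowP (sig0 (modeK m)) (sig1 (modeK m)) (sig2 (modeK m)) (m.1 - off (modeK m))).1 ≤ 1 := (spivot_box4 hV H1 m).1
  unfold srho4
  by_cases h0 : (Ψ.rowP (sig0 (modeK m)) (sig1 (modeK m)) (sig2 (modeK m)) (m.1 - off (modeK m))).1 = 0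
  · rw [if_pos h0, Matrix.fromRows_apply_inl, SU4_srow ζ hV H1, h0]
  · have h1 : (Ψ.rowP (sig0 (modeK m)) (sig1 (modeK m)) (sig2 (modeK m)) (m.1 - off (modeK m))).1 = 1 := by omega
    rw [if_neg h0, Matrix.fromRows_apply_inr, SU4_srow ζ hV H1, h1]

/-- V on a pivot column: supported on the modes of the same type, with value B_σ[ℓ(m), g_{ℓ(m')}]. -/
theorem SV4_gam (hV : Ψ.valid L1 L2 = true) (H1 : ∀ m : Fin r, off (modeK m) ≤ m.1 ∧ m.1 < off (modeK m) + srs4 Ψ (modeK m)) (m m' : Fin r) :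
    SV4 ζ Ψ modeK off m (sgam4 hV H1 m') = if modeK m = modeK m' then
      Z8.eval ζ (Ψ.B (sig0 (modeK m')) (sig1 (modeK m')) (sig2 (modeK m')) (m.1 - off (modeK m'))
        (Ψ.colP (sig0 (modeK m')) (sig1 (modeK m')) (sig2 (modeK m')) (m'.1 - off (modeK m'))).1
        (Ψ.colP (sig0 (modeK m')) (sig1 (modeK m')) (sig2 (modeK m')) (m'.1 - off (modeK m'))).2.1
        (Ψ.colP (sig0 (modeK m')) (sig1 (modeK m')) (sig2 (modeK m')) (m'.1 - off (modeK m'))).2.2) else 0 := by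
  obtain ⟨e0, e2, e4, p0, p1, p2⟩ := sgam4_val hV H1 m'
  unfold SV4
  by_cases hk : modeK m = modeK m'
  · rw [if_pos hk, hk, p0, p1, p2, e0, e2, e4, if_pos ⟨rfl, rfl, rfl⟩]
  · rw [if_neg hk, if_neg]
    intro h
    exact hk (sig_inj _ _ (by omega) (by omega) (by omega))

/-- LOWER BOUND: rank [M_{δ₁} ; M_{δ₂}] ≥ r. -/
theorem le_stackRank_of_cert4 [CharZero K] (h4 : ζ ^ 4 = -1) (hV : Ψ.valid L1 L2 = true)
    (H1 : ∀ m : Fin r, off (modeK m) ≤ m.1 ∧ m.1 < off (modeK m) + srs4 Ψ (modeK m)) (H2 : ∀ k : Fin 6, off k + srs4 Ψ k ≤ r)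
    (H3 : ∀ m : Fin r, ∀ k : Fin 6, off k ≤ m.1 → m.1 < off k + srs4 Ψ k → modeK m = k) :
    r ≤ (Matrix.fromRows (ivhsMatrix 4 4 ζ (planeList4 L1)) (ivhsMatrix 4 4 ζ (planeList4 L2))).rank := by
  classical
  set M := Matrix.fromRows (ivhsMatrix 4 4 ζ (planeList4 L1)) (ivhsMatrix 4 4 ζ (planeList4 L2)) with hM
  set U := Matrix.fromRows (SU4 ζ Ψ modeK off 0) (SU4 ζ Ψ modeK off 1) with hUdef
  have hS : M.submatrix (srho4 hV H1) (sgam4 hV H1) = U.submatrix (srho4 hV H1) id * (SV4 ζ Ψ modeK off).submatrix id (sgam4 hV H1) := by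
    rw [hM, hUdef, ivhsMatrix_stack4_eq_mul ζ L1 L2 Ψ modeK off h4 hV H1 H2 H3]
    exact Matrix.submatrix_mul _ _ _ _ _ Function.bijective_id
  -- the left factor of the minor is lower triangular with nonzero diagonal
  have hUt : (U.submatrix (srho4 hV H1) id).BlockTriangular OrderDual.toDual := by
    intro m m' hlt
    have hlt' : m < m' := OrderDual.toDual_lt_toDual.mp hlt
    rw [Matrix.submatrix_apply, id_eq, hUdef, SU4_rho ζ hV H1]
    by_cases hk : modeK m' = modeK m
    · rw [if_pos hk]
      obtain ⟨l0, l1, l2⟩ := Zprime4.sig_le4 (modeK m)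
      obtain ⟨hℓ, hℓ'⟩ := modeL_lt_of_lt modeK off (srs4 Ψ) H1 hlt' hk
      rw [StackCert.A_upper_zero hV (by omega) (by omega) (by omega) (smodeL_lt4 H1 m) hℓ' hℓ, Z8.zero_def, Z8.eval_zero]
    · rw [if_neg hk]
  have hUd : ∀ m : Fin r, (U.submatrix (srho4 hV H1) id) m m ≠ 0 := by
    intro m
    rw [Matrix.submatrix_apply, id_eq, hUdef, SU4_rho ζ hV H1, if_pos rfl]
    obtain ⟨l0, l1, l2⟩ := Zprime4.sig_le4 (modeK m)
    exact Z8.eval_ne_zero_of_posConst ζ (StackCert.pivots hV (by omega) (by omega) (by omega) (smodeL_lt4 H1 m)).1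
  -- the right factor of the minor is upper triangular with nonzero diagonal
  have hVt : ((SV4 ζ Ψ modeK off).submatrix id (sgam4 hV H1)).BlockTriangular id := by
    intro m m' hlt
    have hlt' : m' < m := hlt
    rw [Matrix.submatrix_apply, id_eq, SV4_gam ζ hV H1]
    by_cases hk : modeK m = modeK m'
    · rw [if_pos hk]
      obtain ⟨l0, l1, l2⟩ := Zprime4.sig_le4 (modeK m')
      obtain ⟨hℓ, hℓ'⟩ := modeL_lt_of_lt modeK off (srs4 Ψ) H1 hlt' hk
      rw [StackCert.B_lower_zero hV (by omega) (by omega) (by omega) (smodeL_lt4 H1 m') hℓ' hℓ, Z8.zero_def, Z8.eval_zero]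
    · rw [if_neg hk]
  have hVd : ∀ m : Fin r, ((SV4 ζ Ψ modeK off).submatrix id (sgam4 hV H1)) m m ≠ 0 := by
    intro m
    rw [Matrix.submatrix_apply, id_eq, SV4_gam ζ hV H1, if_pos rfl]
    obtain ⟨l0, l1, l2⟩ := Zprime4.sig_le4 (modeK m)
    have hBw := Z8.eval_ne_zero_of_posConst ζ (StackCert.pivots hV (by omega) (by omega) (by omega) (smodeL_lt4 H1 m)).2.1
    rw [Z8.eval_mul ζ h4] at hBw
    exact left_ne_zero_of_mul hBw
  have hdet : IsUnit (M.submatrix (srho4 hV H1) (sgam4 hV H1)).det := by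
    rw [hS, Matrix.det_mul, Matrix.det_of_lowerTriangular _ hUt, Matrix.det_of_upperTriangular hVt]
    exact isUnit_iff_ne_zero.mpr (mul_ne_zero (Finset.prod_ne_zero_iff.mpr fun m _ => hUd m)
      (Finset.prod_ne_zero_iff.mpr fun m _ => hVd m))
  have hrank : (M.submatrix (srho4 hV H1) (sgam4 hV H1)).rank = r := by
    rw [Matrix.rank_of_isUnit _ ((Matrix.isUnit_iff_isUnit_det _).mpr hdet), Fintype.card_fin]
  calc r = (M.submatrix (srho4 hV H1) (sgam4 hV H1)).rank := hrank.symm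
    _ ≤ M.rank := Matrix.rank_submatrix_le M _ _

/-- MAIN THEOREM (n = 4, stacked): a valid stacked certificate with a mode enumeration decides rank [M_{δ₁} ; M_{δ₂}] = r. -/
theorem ivhsStackRankEq_of_cert4 (L1 L2 : List (ℤ × ℕ × ℕ × ℕ)) (Ψ : StackCert) (hV : Ψ.valid L1 L2 = true) {r : ℕ}
    (modeK : Fin r → Fin 6) (off : Fin 6 → ℕ) (H1 : ∀ m : Fin r, off (modeK m) ≤ m.1 ∧ m.1 < off (modeK m) + srs4 Ψ (modeK m))
    (H2 : ∀ k : Fin 6, off k + srs4 Ψ k ≤ r) (H3 : ∀ m : Fin r, ∀ k : Fin 6, off k ≤ m.1 → m.1 < off k + srs4 Ψ k → modeK m = k) :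
    ∀ (K : Type) [Field K] [CharZero K] (ζ : K), IsPrimitiveRoot ζ (2 * 4) →
      (Matrix.fromRows (ivhsMatrix 4 4 ζ (planeList4 L1)) (ivhsMatrix 4 4 ζ (planeList4 L2))).rank = r := by
  intro K _ _ ζ hζ
  have h4 : ζ ^ 4 = -1 := zeta_pow_four_of_primitive hζ
  exact le_antisymm (stackRank_le_of_cert4 ζ L1 L2 Ψ modeK off h4 hV H1 H2 H3) (le_stackRank_of_cert4 ζ h4 hV H1 H2 H3)

end cert

end Summit.HodgeConjecture.HodgeConjecture.HodgeLocus.Census.PlaneSum
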